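/-
Copyright: the b2b-balaban T⁴-continuum CRUX team, row NE7b leaf lineage `t4-ne7b-formalise-leaf-01` (gen 91). Project licence.
-/
import Summits.QuantumFields.BalabanUV.T4Continuum.Spine.NE7b.SupBackgroundDataModulus
import Summits.QuantumFields.BalabanUV.T4Continuum.Spine.NE7b.SupBackgroundLocalisation

/-!
# THE BACKGROUND RESPONSE `Dσ(w)` AND THE FLUCTUATION COVARIANCE `C̃(w)` DEPEND LIPSCHITZ-CONTINUOUSLY ON THE POTENTIAL:
# for (60)'s small-field background on `ℓ^∞(ℤ^d)` (`d ≥ 3`, every side), two sitewise terms `u₁`, `u₂` with common letters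
# `(λ, c, N, r)`, `|u₂ − u₁| ≤ δ` and `|u₂′ − u₁′| ≤ δ′` on `[−r, r]` give, on the whole open chart ball,
# `‖Dσ₂(w) − Dσ₁(w)‖ ≤ (1 − 2λN)⁻¹·2N·(δ′ + L₂m₀)·(N⁻¹ − c)⁻¹` and `‖C̃₂(w)g − C̃₁(w)g‖ ≤ (1 − 2λN)⁻¹·2N·(δ′ + L₂m₀)·2(N⁻¹ − c)⁻¹‖g‖`,
# `m₀ = (1 − 2λN)⁻¹·2N·δ` — THE DERIVATIVE-LEVEL DATA MODULUS (row NE7b, node U5c; (60) ∕ (63) ∕ (81) ∕ ASE BY NAME; [folklore])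

Cell `pub-balaban`, sub-cell `t4`, spine estimate NE7b (`T4WeightBudget.RelWeightBound`; the cell's OWN estimate — NOT PRINTED in
[Bałaban 1983–89], NOT PROVED).  Crux-route work under `Spine/NE7b/` on the route of record R-P1 (the sup road) by the NE7b leaf
lineage `t4-ne7b-formalise-leaf-01` (gen 91) under FREEZE (0)'s crux-prover clause, on the OWNER `t4-ne7b-p1` g116's located NEXT item
(3)(iv) «the derivative-level data modulus (`Dσ`, `C̃` Lipschitz in the potential)» (HANDOFF § L.82438) and (81)'s own HONEST line «no
derivative-level modulus (`Dσ` in `u`: the same bootstrap on the linearised system, not typed)»; INTENT-1 I-leaf01-g91-1 (journal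
l.65913).  NOTHING of Bałaban's is named, valued or asserted; no `T4Continuum/Support` leaf typed; no `def`, no notation; zero `sorry`.
Imports (BY NAME): the owner's (81) `…SupBackgroundDataModulus` (`norm_sub_le_of_background_pair`; through it (76), (60) v1.1
`exists_background_covariance`, leaf-06's (57) ASE `exists_aug_equiv_sup`, (51) `abs_blockAvg_le`) and the owner's (63)
`…SupBackgroundLocalisation` (`fibre_eq_of_hasFDerivAt` — the response's fibre equation by differentiation).

WHY (located).  (81) typed the VALUE-level modulus: two potentials `u₁`, `u₂` that are `δ`-close on `[−r, r]` give backgrounds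
`σ₁`, `σ₂` with `‖σ₂w − σ₁w‖ ≤ m₀ := (1 − 2λN)⁻¹·2N·δ` on the chart ball.  Along the flow the objects that are CONSUMED at the next
level are not the backgrounds but their derivatives — the response `Dσ(w)` (the linearised background, (60) §2 ∕ §4) and the fluctuation
covariance `C̃(w)` of the perturbed action at the background ((60) §4, (61) §8) — and the potential changes from level to level (the
rescaling `u ↦ (ℓ+1)⁻²u` of (76) ∕ (80); in print the re-expansion of the small-field effective densities, [B11] ∕ [B12]).  This file is
the derivative-level twin of (81): the SAME bootstrap, run on the LINEARISED system.  For two fields `h₁`, `h₂` with the same block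
means solving `P(Ah_i + g_i) = k` with the same right side, `h₂ − h₁ = T⁻¹(0, P(A(h₂ − h₁)))` (ASE's chart) and
`P(A(h₂ − h₁)) = −P(g₂ − g₁)`, so `‖h₂ − h₁‖ ≤ 2N‖g₂ − g₁‖`; with the multiplier letter `‖g₂ − g₁‖ ≤ η‖h₂‖ + λ‖h₂ − h₁‖`
(`g_i = (u_i′∘σ_iw)·h_i`, `η = δ′ + L₂‖σ₂w − σ₁w‖`) the bootstrap closes under (60)'s `2λN < 1` (§1).  Applied to `h_i = Dσ_i(w)h`
(`k = 0`) and to `h_i = C̃_i(w)g` (`k = Pg`) it gives the two displayed moduli (§3).  One input is not among (60)'s exports — the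
fibre equation of the RESPONSE, `P(A(Dσ(w)h) + (u′∘σw)·Dσ(w)h) = 0` ((60) §4 exports it for `C̃(w)g` with right side `Pg`, and for
`Dσ(w)` only `HasFDerivAt`, `‖Dσ(w)‖ ≤ (N⁻¹ − c)⁻¹`, `Q′∘Dσ(w) = 1`): it is the owner's (63) §2 `fibre_eq_of_hasFDerivAt` (differentiate
`P(Aσ + u∘σ) ≡ 0` near an interior `w` — chain rule with (58)'s `C¹` Nemytskii map, uniqueness of the Fréchet derivative), which §2
reads BY NAME in the given-multiplier ∕ open-set form that §3 consumes (the EL equation holds on the closed chart ball ⊇ the open one).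

WHAT IS PROVED ([folklore]; `ℓ^∞ := lp (fun _ : X d => ℝ) ∞`):
* §1 `norm_fibreProj_le` (`‖Pf‖ ≤ 2‖f‖` for the displayed `P = 1 − Q′*Q′`), `norm_mulSub_le` (the multiplier letter:
  `g_i = m_i·h_i` sitewise, `|m₁| ≤ λ`, `|m₂ − m₁| ≤ η` ⟹ `‖g₂ − g₁‖ ≤ η‖h₂‖ + λ‖h₂ − h₁‖`), **`norm_sub_le_of_linearised_pair`**
  (ASE's chart `T h = (Q′h, P(Ah))` with `‖T⁻¹‖ ≤ N`; `Q′h₁ = Q′h₂`, `P(Ah₁ + g₁) = k = P(Ah₂ + g₂)`, the multiplier letter, `2λN < 1`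
  ⟹ `‖h₂ − h₁‖ ≤ (1 − 2λN)⁻¹·2N·η·‖h₂‖`).
* §2 **`fibreProj_linearised_eq_zero`** — (63) `fibre_eq_of_hasFDerivAt` BY NAME, restated for a GIVEN multiplier family `N′`
  (`N′φ h = (u′∘φ)·h`) and an open set `s` of validity: for ANY map `σ` solving the sitewise Euler–Lagrange system for `u` on `s` and
  differentiable at `w ∈ s` with derivative `D`, `P(A(Dh) + N′(σw)(Dh)) = 0` for every `h`.
* §3 **`exists_background_pair_deriv_modulus`** — `d ≥ 3`, `a > 0`, (60)'s data for `u₁` (`Lip u₁′ ≤ L₁`) and `u₂` (`Lip u₂′ ≤ L₂`)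
  with common `(λ, c, N, r)`, `|u₂ t − u₁ t| ≤ δ` and `|u₂′ t − u₁′ t| ≤ δ′` for `|t| ≤ r` ⟹ (60)'s operators `Q′, A, P`, multiplier
  families `N₁′, N₂′`, backgrounds `σ₁, σ₂` (closed-ball letters, Lipschitz) and covariances `C̃₁, C̃₂` exist with: on the closed chart
  ball `‖σ₂w − σ₁w‖ ≤ m₀` ((81) re-delivered); on the OPEN chart ball the responses `D₁ = Dσ₁(w)`, `D₂ = Dσ₂(w)` (`HasFDerivAt`,
  `‖D_i‖ ≤ (N⁻¹ − c)⁻¹`, `Q′∘D_i = 1`, the fibre equations `P(A(D_ih) + N_i′(σ_iw)(D_ih)) = 0`) with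
  **`‖D₂ − D₁‖ ≤ (1 − 2λN)⁻¹·2N·(δ′ + L₂m₀)·(N⁻¹ − c)⁻¹`**, and the covariances' letters (`Q′(C̃_i(w)g) = 0`, fibre equations with
  right side `Pg`, `‖C̃_i(w)g‖ ≤ 2(N⁻¹ − c)⁻¹‖g‖`) with **`‖C̃₂(w)g − C̃₁(w)g‖ ≤ (1 − 2λN)⁻¹·2N·(δ′ + L₂m₀)·2(N⁻¹ − c)⁻¹·‖g‖`**.
* §4 toy.

HONEST (what this is NOT).  Sup-norm Banach bookkeeping on the scalar `ℤ^d` skeleton with a sitewise perturbation (`u′` bounded and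
Lipschitz GLOBALLY); the potential is a global datum (sup over `[−r, r]`, no locality); constants existential and useless by value at
small sides in the pure-sup currency; the moduli are linear in `(δ, δ′)` with the displayed (not optimised) constants; no second
derivative `D²σ`; no modulus of the CONSTANTS in the potential; nothing of the covariant `H_k`, `G_k(U)` ((A3) ∕ (A1c); NC-NE7b-α
UNRULED); anything of Bałaban's.  BY-NAME EFFECT ON THE WALL: NONE.  NE7b NOT PRINTED ∕ NOT PROVED; spine PROVED 0∕9; rung (B)+1 on a
FINITE torus — NOT infinite volume, NOT the mass gap, NOT Clay.  HONEST DEPENDENCY: continuum YM on T⁴ ⇐ BetaPertH ∧ nine spine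
estimates (0∕9 proved); BetaPertH ⇐ (D1) ∧ (D4) ∧ CAP+tail; G-an2-4 gates asym, D1 and NE2∕3∕4.
-/

set_option autoImplicit false

noncomputable section

namespace Summit.QuantumFields.BalabanUV.T4Continuum.NE7b.SupBackgroundDerivDataModulus

open scoped ENNReal NNReal Topology
open Metric Set Filter
open Literature.MathematicalPhysics.QuantumFieldTheory.Balaban1983to89
open B4Sect5Proof (latticeConst latticeConst_nonneg)
open B6QGQLower276 (X e blk B mem_B sum_B_const AX)
open B6QGQDecay237 (deltaU deltaU_pos)
open B5Hk103ScalarZd (nbhd deltaH deltaH_pos)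
open Summit.QuantumFields.BalabanUV.Beta.D1BFx.BlockColumnSupNorm (cHs cHs_nonneg)
open Summit.QuantumFields.BalabanUV.Beta.D1BFx.PointColumnSplit (cKL cG0 cSplit)
open Summit.QuantumFields.BalabanUV.Beta.D1BFx.PointColumnDecay (cFar)
open OneShotChartSupOperator (abs_apply_le_norm)
open FibreInverseSupNorm (abs_blockAvg_le)
open AugmentedSupEquivalence (exists_aug_equiv_sup)
open SupSmallFieldBackground (exists_background_covariance)
open SupBackgroundDataModulus (norm_sub_le_of_background_pair)
open SupBackgroundLocalisation (fibre_eq_of_hasFDerivAt)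

variable {d : ℕ}

/-! ## §1. The bootstrap for a pair of solutions of the LINEARISED systems -/

section Pair

variable {n : ℕ} {Dop Aop Pop : lp (fun _ : X d => ℝ) ∞ →L[ℝ] lp (fun _ : X d => ℝ) ∞}

/-- `‖P f‖ ≤ 2‖f‖` for the displayed fibre projection `(P f)(q) = f(q) − (n+1)^{−d} Σ_{B(blk q)} f`. [folklore] -/
theorem norm_fibreProj_le
    (hP : ∀ (f : lp (fun _ : X d => ℝ) ∞) (p : X d), Pop f p = f p - (((n : ℝ) + 1) ^ d)⁻¹ * ∑ p' ∈ B n (blk n p), f p')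
    (f : lp (fun _ : X d => ℝ) ∞) : ‖Pop f‖ ≤ 2 * ‖f‖ := by
  refine lp.norm_le_of_forall_le (by positivity) fun q => ?_
  rw [Real.norm_eq_abs, hP]
  calc _ ≤ |f q| + |(((n : ℝ) + 1) ^ d)⁻¹ * ∑ p' ∈ B n (blk n q), f p'| := abs_sub _ _
    _ ≤ ‖f‖ + ‖f‖ :=
        add_le_add (abs_apply_le_norm f q) (abs_blockAvg_le n (fun p' => abs_apply_le_norm f p') (blk n q))
    _ = 2 * ‖f‖ := by ring

/-- **THE MULTIPLIER LETTER**: sitewise `g₁ = m₁·h₁`, `g₂ = m₂·h₂` with `|m₁| ≤ λ` and `|m₂ − m₁| ≤ η` give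
`‖g₂ − g₁‖ ≤ η‖h₂‖ + λ‖h₂ − h₁‖` (`m₂h₂ − m₁h₁ = (m₂ − m₁)h₂ + m₁(h₂ − h₁)`). [folklore] -/
theorem norm_mulSub_le {m₁ m₂ : X d → ℝ} {g₁ g₂ h₁ h₂ : lp (fun _ : X d => ℝ) ∞}
    (hg₁ : ∀ p, g₁ p = m₁ p * h₁ p) (hg₂ : ∀ p, g₂ p = m₂ p * h₂ p)
    {lam η : ℝ} (hlam0 : 0 ≤ lam) (hη0 : 0 ≤ η) (hm₁ : ∀ p, |m₁ p| ≤ lam) (hm : ∀ p, |m₂ p - m₁ p| ≤ η) :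
    ‖g₂ - g₁‖ ≤ η * ‖h₂‖ + lam * ‖h₂ - h₁‖ := by
  refine lp.norm_le_of_forall_le (by positivity) fun p => ?_
  rw [Real.norm_eq_abs, lp.coeFn_sub, Pi.sub_apply, hg₁, hg₂]
  have e : m₂ p * h₂ p - m₁ p * h₁ p = (m₂ p - m₁ p) * h₂ p + m₁ p * (h₂ p - h₁ p) := by ring
  have h2 : |h₂ p - h₁ p| ≤ ‖h₂ - h₁‖ := by
    have h := abs_apply_le_norm (h₂ - h₁) p
    rwa [lp.coeFn_sub, Pi.sub_apply] at h
  rw [e]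
  calc _ ≤ |(m₂ p - m₁ p) * h₂ p| + |m₁ p * (h₂ p - h₁ p)| := abs_add_le _ _
    _ = |m₂ p - m₁ p| * |h₂ p| + |m₁ p| * |h₂ p - h₁ p| := by rw [abs_mul, abs_mul]
    _ ≤ η * ‖h₂‖ + lam * ‖h₂ - h₁‖ :=
        add_le_add (mul_le_mul (hm p) (abs_apply_le_norm h₂ p) (abs_nonneg _) hη0)
          (mul_le_mul (hm₁ p) h2 (abs_nonneg _) hlam0)

/-- **THE LINEARISED BOOTSTRAP**: with ASE's chart `T h = (Q′h, P(Ah))`, `‖T⁻¹ y‖ ≤ N‖y‖`, `‖P‖ ≤ 2`, two fields with the SAME block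
means solving `P(Ah₁ + g₁) = k`, `P(Ah₂ + g₂) = k` (same right side), the multiplier letter `‖g₂ − g₁‖ ≤ η‖h₂‖ + λ‖h₂ − h₁‖` and
`2λN < 1`: `‖h₂ − h₁‖ ≤ (1 − 2λN)⁻¹·2N·η·‖h₂‖` — because `h₂ − h₁ = T⁻¹(0, P(A(h₂ − h₁)))` and `P(A(h₂ − h₁)) = −P(g₂ − g₁)`.
[folklore] -/
theorem norm_sub_le_of_linearised_pair
    (Rop : lp (fun _ : X d => ℝ) ∞ →L[ℝ] Dop.ker) (hR : ∀ h, (Rop h : lp (fun _ : X d => ℝ) ∞) = Pop (Aop h))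
    (T : lp (fun _ : X d => ℝ) ∞ ≃L[ℝ] (lp (fun _ : X d => ℝ) ∞) × Dop.ker) (hT : ∀ h, T h = (Dop h, Rop h))
    {N : ℝ} (hN0 : 0 ≤ N) (hTN : ∀ y, ‖T.symm y‖ ≤ N * ‖y‖)
    (hPn : ∀ f : lp (fun _ : X d => ℝ) ∞, ‖Pop f‖ ≤ 2 * ‖f‖)
    {h₁ h₂ g₁ g₂ k : lp (fun _ : X d => ℝ) ∞} (hD : Dop h₁ = Dop h₂)
    (he₁ : Pop (Aop h₁ + g₁) = k) (he₂ : Pop (Aop h₂ + g₂) = k)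
    {lam η : ℝ} (hg : ‖g₂ - g₁‖ ≤ η * ‖h₂‖ + lam * ‖h₂ - h₁‖) (hsmall : 2 * lam * N < 1) :
    ‖h₂ - h₁‖ ≤ (1 - 2 * lam * N)⁻¹ * (2 * N * η * ‖h₂‖) := by
  -- `P(A(h₂ − h₁)) = −P(g₂ − g₁)`
  have hPA : Pop (Aop (h₂ - h₁)) = -Pop (g₂ - g₁) := by
    have e : Pop (Aop h₂ + g₂) - Pop (Aop h₁ + g₁) = 0 := by rw [he₁, he₂, sub_self]
    have e2 : Aop h₂ + g₂ - (Aop h₁ + g₁) = Aop (h₂ - h₁) + (g₂ - g₁) := by rw [map_sub]; abel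
    rw [← map_sub, e2, map_add] at e
    exact eq_neg_of_add_eq_zero_left e
  -- `h₂ − h₁ = T⁻¹(0, R(h₂ − h₁))`
  have hψ : h₂ - h₁ = T.symm (0, Rop (h₂ - h₁)) := by
    have h := (ContinuousLinearEquiv.symm_apply_apply T (h₂ - h₁)).symm
    rwa [hT, map_sub Dop, hD, sub_self] at h
  have hnorm : ‖h₂ - h₁‖ ≤ N * (2 * (η * ‖h₂‖ + lam * ‖h₂ - h₁‖)) := by
    have h := hTN (0, Rop (h₂ - h₁))
    rw [← hψ, Prod.norm_mk, norm_zero, max_eq_right (norm_nonneg _), Submodule.coe_norm, hR, hPA, norm_neg] at h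
    exact h.trans (mul_le_mul_of_nonneg_left ((hPn _).trans (mul_le_mul_of_nonneg_left hg zero_le_two)) hN0)
  have hpos : 0 < 1 - 2 * lam * N := sub_pos.2 hsmall
  rw [le_inv_mul_iff₀' hpos]
  nlinarith [norm_nonneg (h₂ - h₁), norm_nonneg h₂]

end Pair

/-! ## §2. The response solves the homogeneous fibre equation of the linearised action ((63) BY NAME) -/

section Linearised

variable {n : ℕ} {Aop Pop : lp (fun _ : X d => ℝ) ∞ →L[ℝ] lp (fun _ : X d => ℝ) ∞}

/-- **THE FIBRE EQUATION OF THE RESPONSE** ((63) `fibre_eq_of_hasFDerivAt` BY NAME, given-multiplier ∕ open-set form).  `σ` solves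
the sitewise Euler–Lagrange system for `u` (`Aσw + u∘σw` block-constant) at every point of an OPEN set `s`; `σ` has Fréchet derivative
`D` at `w ∈ s`; `u ∈ C¹` with `|u′| ≤ λ`, `u′` `L`-Lipschitz; `N′φ h = (u′∘φ)·h` sitewise.  Then `P(A(Dh) + N′(σw)(Dh)) = 0` for every
`h` — (63) differentiates `w′ ↦ P(Aσw′ + u∘σw′) ≡ 0` at `w`; its multiplier `Nop` and the given `N′(σw)` agree by extensionality.
[folklore] -/
theorem fibreProj_linearised_eq_zero
    (hP : ∀ (f : lp (fun _ : X d => ℝ) ∞) (p : X d), Pop f p = f p - (((n : ℝ) + 1) ^ d)⁻¹ * ∑ p' ∈ B n (blk n p), f p')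
    {u u' : ℝ → ℝ} (hu : ∀ t, HasDerivAt u (u' t) t) {lam L : ℝ} (hlam : ∀ t, |u' t| ≤ lam)
    (hL0 : 0 ≤ L) (hL : ∀ s t, |u' s - u' t| ≤ L * |s - t|)
    (N' : lp (fun _ : X d => ℝ) ∞ → (lp (fun _ : X d => ℝ) ∞ →L[ℝ] lp (fun _ : X d => ℝ) ∞))
    (hN' : ∀ (φ h : lp (fun _ : X d => ℝ) ∞) (p : X d), N' φ h p = u' (φ p) * h p)
    {σ : lp (fun _ : X d => ℝ) ∞ → lp (fun _ : X d => ℝ) ∞} {s : Set (lp (fun _ : X d => ℝ) ∞)} (hs : IsOpen s)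
    (hEL : ∀ w ∈ s, ∀ p : X d, Aop (σ w) p + u (σ w p)
      = (((n : ℝ) + 1) ^ d)⁻¹ * ∑ p' ∈ B n (blk n p), (Aop (σ w) p' + u (σ w p')))
    {w : lp (fun _ : X d => ℝ) ∞} (hw : w ∈ s) {D : lp (fun _ : X d => ℝ) ∞ →L[ℝ] lp (fun _ : X d => ℝ) ∞}
    (hσ : HasFDerivAt σ D w) (h : lp (fun _ : X d => ℝ) ∞) :
    Pop (Aop (D h) + N' (σ w) (D h)) = 0 := by
  obtain ⟨Nop, hNop, hfib⟩ := fibre_eq_of_hasFDerivAt n Aop Pop hP hu hlam hL0 hL (hs.mem_nhds hw) hEL hσ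
  -- (63)'s multiplier and the given family agree at `σ w`
  have hNN : Nop = N' (σ w) := ContinuousLinearMap.ext fun g => lp.ext (funext fun p => by rw [hNop, hN'])
  rw [← hNN]
  exact hfib h

end Linearised

/-! ## §3. (60) §4 for two potentials: the response and the covariance are Lipschitz in the potential -/

/-- **THE DERIVATIVE-LEVEL DATA MODULUS** (`d ≥ 3`, `a > 0`; two sitewise terms `u₁`, `u₂` with (60)'s letters for a common
`(λ, c, N, r)`, `Lip u₁′ ≤ L₁`, `Lip u₂′ ≤ L₂`, `|u₂ t − u₁ t| ≤ δ` and `|u₂′ t − u₁′ t| ≤ δ′` for `|t| ≤ r`).  With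
`m₀ := (1 − 2λN)⁻¹·2N·δ` and `η := δ′ + L₂·m₀`: (60)'s operators `Q′, A, P`, the multiplier families `N₁′, N₂′`, the two backgrounds
`σ₁, σ₂` (closed-ball letters, Lipschitz) and the two covariance families `C̃₁, C̃₂` exist, AND: on the closed chart ball
`‖σ₂w − σ₁w‖ ≤ m₀` ((81)); on the open chart ball the responses `D₁, D₂` (`HasFDerivAt σ_i D_i w`, `‖D_i‖ ≤ (N⁻¹ − c)⁻¹`, `Q′∘D_i = 1`,
`P(A(D_ih) + N_i′(σ_iw)(D_ih)) = 0`) with **`‖D₂ − D₁‖ ≤ (1 − 2λN)⁻¹·2N·η·(N⁻¹ − c)⁻¹`**; and the covariances (`Q′(C̃_i(w)g) = 0`,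
`P(A(C̃_i(w)g) + N_i′(σ_iw)(C̃_i(w)g)) = Pg`, `‖C̃_i(w)g‖ ≤ 2(N⁻¹ − c)⁻¹‖g‖`) with **`‖C̃₂(w)g − C̃₁(w)g‖ ≤ (1 − 2λN)⁻¹·2N·η·2(N⁻¹ − c)⁻¹·‖g‖`**.
[folklore] -/
theorem exists_background_pair_deriv_modulus (hd : 3 ≤ d) (n : ℕ) {a : ℝ} (ha : 0 < a)
    {u₁ u₁' u₂ u₂' : ℝ → ℝ} (hu₁ : ∀ t, HasDerivAt u₁ (u₁' t) t) (hu₁0 : u₁ 0 = 0) (hu₂ : ∀ t, HasDerivAt u₂ (u₂' t) t)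
    (hu₂0 : u₂ 0 = 0) {lam c N : ℝ≥0} (hlam₁ : ∀ t, |u₁' t| ≤ lam) (hlam₂ : ∀ t, |u₂' t| ≤ lam)
    {L₁ L₂ : ℝ} (hL₁0 : 0 ≤ L₁) (hL₁ : ∀ s t, |u₁' s - u₁' t| ≤ L₁ * |s - t|) (hL₂0 : 0 ≤ L₂)
    (hL₂ : ∀ s t, |u₂' s - u₂' t| ≤ L₂ * |s - t|)
    (hN : cHs d a * latticeConst d (deltaH d a)
        + ((cG0 d * cKL d (d - 2) + cSplit d a) * Real.exp (2 * deltaU d a)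
            + cFar d a * Real.exp (4 * deltaU d a) / deltaU d a ^ 2) * latticeConst d (deltaU d a / 4)
          * (1 + cHs d a * latticeConst d (deltaH d a)) ≤ (N : ℝ))
    (hc : 2 * lam ≤ c) (hcN : c < N⁻¹) {r : ℝ} (hr : 0 ≤ r) {δ δ' : ℝ} (hδ : ∀ t, |t| ≤ r → |u₂ t - u₁ t| ≤ δ)
    (hδ' : ∀ t, |t| ≤ r → |u₂' t - u₁' t| ≤ δ') :
    ∃ (Dop Aop Pop : lp (fun _ : X d => ℝ) ∞ →L[ℝ] lp (fun _ : X d => ℝ) ∞)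
      (N₁' N₂' : lp (fun _ : X d => ℝ) ∞ → (lp (fun _ : X d => ℝ) ∞ →L[ℝ] lp (fun _ : X d => ℝ) ∞))
      (σ₁ σ₂ : lp (fun _ : X d => ℝ) ∞ → lp (fun _ : X d => ℝ) ∞)
      (Cf₁ Cf₂ : lp (fun _ : X d => ℝ) ∞ → (lp (fun _ : X d => ℝ) ∞ →L[ℝ] lp (fun _ : X d => ℝ) ∞)),
      (∀ (f : lp (fun _ : X d => ℝ) ∞) (y : X d), Dop f y = (((n : ℝ) + 1) ^ d)⁻¹ * ∑ p ∈ B n y, f p) ∧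
      (∀ (f : lp (fun _ : X d => ℝ) ∞) (p : X d), Aop f p = ∑ r ∈ nbhd n p, AX n a p r * f r) ∧
      (∀ (f : lp (fun _ : X d => ℝ) ∞) (p : X d), Pop f p = f p - (((n : ℝ) + 1) ^ d)⁻¹ * ∑ p' ∈ B n (blk n p), f p') ∧
      (∀ (φ h : lp (fun _ : X d => ℝ) ∞) (p : X d), N₁' φ h p = u₁' (φ p) * h p) ∧
      (∀ (φ h : lp (fun _ : X d => ℝ) ∞) (p : X d), N₂' φ h p = u₂' (φ p) * h p) ∧
      σ₁ 0 = 0 ∧ σ₂ 0 = 0 ∧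
      (∀ w ∈ closedBall (0 : lp (fun _ : X d => ℝ) ∞) (((N : ℝ)⁻¹ - c) * r),
        σ₁ w ∈ closedBall 0 r ∧ Dop (σ₁ w) = w ∧
          ∀ p : X d, Aop (σ₁ w) p + u₁ (σ₁ w p)
            = (((n : ℝ) + 1) ^ d)⁻¹ * ∑ p' ∈ B n (blk n p), (Aop (σ₁ w) p' + u₁ (σ₁ w p'))) ∧
      (∀ w ∈ closedBall (0 : lp (fun _ : X d => ℝ) ∞) (((N : ℝ)⁻¹ - c) * r),
        σ₂ w ∈ closedBall 0 r ∧ Dop (σ₂ w) = w ∧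
          ∀ p : X d, Aop (σ₂ w) p + u₂ (σ₂ w p)
            = (((n : ℝ) + 1) ^ d)⁻¹ * ∑ p' ∈ B n (blk n p), (Aop (σ₂ w) p' + u₂ (σ₂ w p'))) ∧
      LipschitzOnWith (N⁻¹ - c)⁻¹ σ₁ (closedBall (0 : lp (fun _ : X d => ℝ) ∞) (((N : ℝ)⁻¹ - c) * r)) ∧
      LipschitzOnWith (N⁻¹ - c)⁻¹ σ₂ (closedBall (0 : lp (fun _ : X d => ℝ) ∞) (((N : ℝ)⁻¹ - c) * r)) ∧
      (∀ w ∈ closedBall (0 : lp (fun _ : X d => ℝ) ∞) (((N : ℝ)⁻¹ - c) * r),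
        ‖σ₂ w - σ₁ w‖ ≤ (1 - 2 * (lam : ℝ) * N)⁻¹ * (2 * N * δ)) ∧
      (∀ w ∈ ball (0 : lp (fun _ : X d => ℝ) ∞) (((N : ℝ)⁻¹ - c) * r),
        ∃ D₁ D₂ : lp (fun _ : X d => ℝ) ∞ →L[ℝ] lp (fun _ : X d => ℝ) ∞,
          HasFDerivAt σ₁ D₁ w ∧ HasFDerivAt σ₂ D₂ w ∧
          ‖D₁‖ ≤ ((N : ℝ)⁻¹ - c)⁻¹ ∧ ‖D₂‖ ≤ ((N : ℝ)⁻¹ - c)⁻¹ ∧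
          Dop.comp D₁ = ContinuousLinearMap.id ℝ (lp (fun _ : X d => ℝ) ∞) ∧
          Dop.comp D₂ = ContinuousLinearMap.id ℝ (lp (fun _ : X d => ℝ) ∞) ∧
          (∀ h : lp (fun _ : X d => ℝ) ∞, Pop (Aop (D₁ h) + N₁' (σ₁ w) (D₁ h)) = 0) ∧
          (∀ h : lp (fun _ : X d => ℝ) ∞, Pop (Aop (D₂ h) + N₂' (σ₂ w) (D₂ h)) = 0) ∧
          ‖D₂ - D₁‖ ≤ (1 - 2 * (lam : ℝ) * N)⁻¹
            * (2 * N * (δ' + L₂ * ((1 - 2 * (lam : ℝ) * N)⁻¹ * (2 * N * δ)))) * ((N : ℝ)⁻¹ - c)⁻¹) ∧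
      (∀ w ∈ ball (0 : lp (fun _ : X d => ℝ) ∞) (((N : ℝ)⁻¹ - c) * r),
        (∀ g : lp (fun _ : X d => ℝ) ∞, Dop (Cf₁ w g) = 0 ∧ Dop (Cf₂ w g) = 0) ∧
        (∀ g : lp (fun _ : X d => ℝ) ∞, Pop (Aop (Cf₁ w g) + N₁' (σ₁ w) (Cf₁ w g)) = Pop g ∧
          Pop (Aop (Cf₂ w g) + N₂' (σ₂ w) (Cf₂ w g)) = Pop g) ∧
        (∀ g : lp (fun _ : X d => ℝ) ∞, ‖Cf₁ w g‖ ≤ 2 * ((N : ℝ)⁻¹ - c)⁻¹ * ‖g‖ ∧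
          ‖Cf₂ w g‖ ≤ 2 * ((N : ℝ)⁻¹ - c)⁻¹ * ‖g‖) ∧
        (∀ g : lp (fun _ : X d => ℝ) ∞, ‖Cf₂ w g - Cf₁ w g‖ ≤ (1 - 2 * (lam : ℝ) * N)⁻¹
            * (2 * N * (δ' + L₂ * ((1 - 2 * (lam : ℝ) * N)⁻¹ * (2 * N * δ)))) * (2 * ((N : ℝ)⁻¹ - c)⁻¹) * ‖g‖)) := by
  -- (60) §4 for each potential, operators identified by their displayed actions
  obtain ⟨Dop, Aop, Pop, N₁', σ₁, Cf₁, hD, hA, hP, hN₁', hσ₁0, hσ₁, hlip₁, hint₁, -⟩ :=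
    exists_background_covariance hd n ha hu₁ hu₁0 hlam₁ hL₁0 hL₁ hN hc hcN hr
  obtain ⟨Dop', Aop', Pop', N₂', σ₂, Cf₂, hD', hA', hP', hN₂', hσ₂0, hσ₂, hlip₂, hint₂, -⟩ :=
    exists_background_covariance hd n ha hu₂ hu₂0 hlam₂ hL₂0 hL₂ hN hc hcN hr
  have eD : Dop' = Dop := ContinuousLinearMap.ext fun f => lp.ext (funext fun p => by rw [hD, hD'])
  have eA : Aop' = Aop := ContinuousLinearMap.ext fun f => lp.ext (funext fun p => by rw [hA, hA'])
  have eP : Pop' = Pop := ContinuousLinearMap.ext fun f => lp.ext (funext fun p => by rw [hP, hP'])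
  subst eD eA eP
  -- ASE's chart, identified with (60)'s operators
  obtain ⟨Dop'', Aop'', Pop'', hD'', hA'', hP'', -, -, Rop, hR, T, hT, -, hTN⟩ := exists_aug_equiv_sup hd n ha
  have eD : Dop'' = Dop' := ContinuousLinearMap.ext fun f => lp.ext (funext fun p => by rw [hD', hD''])
  have eA : Aop'' = Aop' := ContinuousLinearMap.ext fun f => lp.ext (funext fun p => by rw [hA', hA''])
  have eP : Pop'' = Pop' := ContinuousLinearMap.ext fun f => lp.ext (funext fun p => by rw [hP', hP''])
  subst eD eA eP
  have hTN' : ∀ y, ‖T.symm y‖ ≤ (N : ℝ) * ‖y‖ := fun y =>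
    (hTN y).trans (mul_le_mul_of_nonneg_right hN (norm_nonneg y))
  -- smallness `2λN < 1` and the signs of the constants
  have hcN' : (c : ℝ) < (N : ℝ)⁻¹ := by
    have h := NNReal.coe_lt_coe.2 hcN
    rwa [NNReal.coe_inv] at h
  have hK0 : (0 : ℝ) ≤ ((N : ℝ)⁻¹ - c)⁻¹ := inv_nonneg.2 (sub_nonneg.2 hcN'.le)
  have hNpos : (0 : ℝ) < N := by
    have h : (0 : ℝ) < (N : ℝ)⁻¹ := lt_of_le_of_lt c.coe_nonneg hcN'
    exact inv_pos.mp h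
  have hsmall : 2 * (lam : ℝ) * N < 1 := by
    have h1 : 2 * (lam : ℝ) * N ≤ c * N := mul_le_mul_of_nonneg_right (by exact_mod_cast hc) N.coe_nonneg
    have h2 : (c : ℝ) * N < (N : ℝ)⁻¹ * N := mul_lt_mul_of_pos_right hcN' hNpos
    rw [inv_mul_cancel₀ hNpos.ne'] at h2
    exact h1.trans_lt h2
  have hpos : (0 : ℝ) < 1 - 2 * (lam : ℝ) * N := sub_pos.2 hsmall
  have hδ0 : 0 ≤ δ := (abs_nonneg _).trans (hδ 0 (by rw [abs_zero]; exact hr))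
  have hδ'0 : 0 ≤ δ' := (abs_nonneg _).trans (hδ' 0 (by rw [abs_zero]; exact hr))
  have hm0 : 0 ≤ (1 - 2 * (lam : ℝ) * N)⁻¹ * (2 * N * δ) :=
    mul_nonneg (inv_nonneg.2 hpos.le) (by positivity)
  have hη0 : 0 ≤ δ' + L₂ * ((1 - 2 * (lam : ℝ) * N)⁻¹ * (2 * N * δ)) := add_nonneg hδ'0 (mul_nonneg hL₂0 hm0)
  -- `u₂` is `λ`-Lipschitz
  have hul : ∀ s t, |u₂ s - u₂ t| ≤ (lam : ℝ) * |s - t| := fun s t => by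
    have hderiv : ∀ x ∈ uIcc t s, HasDerivWithinAt u₂ (u₂' x) (uIcc t s) x := fun x _ => (hu₂ x).hasDerivWithinAt
    have hbound : ∀ x ∈ uIcc t s, ‖u₂' x‖ ≤ lam := fun x _ => by rw [Real.norm_eq_abs]; exact hlam₂ x
    have h := Convex.norm_image_sub_le_of_norm_hasDerivWithin_le hderiv hbound (convex_uIcc t s) left_mem_uIcc
      right_mem_uIcc
    rwa [Real.norm_eq_abs, Real.norm_eq_abs] at h
  have hPn : ∀ f : lp (fun _ : X d => ℝ) ∞, ‖Pop'' f‖ ≤ 2 * ‖f‖ := norm_fibreProj_le hP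
  -- (81): the value-level modulus on the closed chart ball
  have hmod0 : ∀ w ∈ closedBall (0 : lp (fun _ : X d => ℝ) ∞) (((N : ℝ)⁻¹ - c) * r),
      ‖σ₂ w - σ₁ w‖ ≤ (1 - 2 * (lam : ℝ) * N)⁻¹ * (2 * N * δ) := fun w hw => by
    obtain ⟨hb₁, hD₁, hE₁⟩ := hσ₁ w hw
    obtain ⟨-, hD₂, hE₂⟩ := hσ₂ w hw
    rw [mem_closedBall, dist_zero_right] at hb₁
    exact norm_sub_le_of_background_pair hP Rop hR T hT N.2 hTN' lam.2 hul (hD₁.trans hD₂.symm) hE₁ hE₂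
      (fun q => hδ _ ((abs_apply_le_norm (σ₁ w) q).trans hb₁)) hsmall
  -- the multiplier letter at an interior point: `|u₂′(σ₂w q) − u₁′(σ₁w q)| ≤ η`
  have hmul : ∀ w ∈ ball (0 : lp (fun _ : X d => ℝ) ∞) (((N : ℝ)⁻¹ - c) * r), ∀ q : X d,
      |u₂' (σ₂ w q) - u₁' (σ₁ w q)| ≤ δ' + L₂ * ((1 - 2 * (lam : ℝ) * N)⁻¹ * (2 * N * δ)) := fun w hw q => by
    have hw' : w ∈ closedBall (0 : lp (fun _ : X d => ℝ) ∞) (((N : ℝ)⁻¹ - c) * r) := ball_subset_closedBall hw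
    obtain ⟨hb₁, -, -⟩ := hσ₁ w hw'
    rw [mem_closedBall, dist_zero_right] at hb₁
    have h1 : |σ₂ w q - σ₁ w q| ≤ (1 - 2 * (lam : ℝ) * N)⁻¹ * (2 * N * δ) := by
      have h := abs_apply_le_norm (σ₂ w - σ₁ w) q
      rw [lp.coeFn_sub, Pi.sub_apply] at h
      exact h.trans (hmod0 w hw')
    calc |u₂' (σ₂ w q) - u₁' (σ₁ w q)|
        = |(u₂' (σ₁ w q) - u₁' (σ₁ w q)) + (u₂' (σ₂ w q) - u₂' (σ₁ w q))| := by ring_nf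
      _ ≤ |u₂' (σ₁ w q) - u₁' (σ₁ w q)| + |u₂' (σ₂ w q) - u₂' (σ₁ w q)| := abs_add_le _ _
      _ ≤ δ' + L₂ * ((1 - 2 * (lam : ℝ) * N)⁻¹ * (2 * N * δ)) :=
          add_le_add (hδ' _ ((abs_apply_le_norm (σ₁ w) q).trans hb₁))
            ((hL₂ _ _).trans (mul_le_mul_of_nonneg_left h1 hL₂0))
  refine ⟨Dop'', Aop'', Pop'', N₁', N₂', σ₁, σ₂, Cf₁, Cf₂, hD, hA, hP, hN₁', hN₂', hσ₁0, hσ₂0, hσ₁, hσ₂, hlip₁, hlip₂,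
    hmod0, fun w hw => ?_, fun w hw => ?_⟩
  · -- the responses
    obtain ⟨⟨D₁, hD₁d, hD₁n, hD₁id⟩, -, -, -, -, -⟩ := hint₁ w hw
    obtain ⟨⟨D₂, hD₂d, hD₂n, hD₂id⟩, -, -, -, -, -⟩ := hint₂ w hw
    have hlin₁ : ∀ h, Pop'' (Aop'' (D₁ h) + N₁' (σ₁ w) (D₁ h)) = 0 := fun h =>
      fibreProj_linearised_eq_zero hP hu₁ hlam₁ hL₁0 hL₁ N₁' hN₁' isOpen_ball
        (fun w' hw' => (hσ₁ w' (ball_subset_closedBall hw')).2.2) hw hD₁d h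
    have hlin₂ : ∀ h, Pop'' (Aop'' (D₂ h) + N₂' (σ₂ w) (D₂ h)) = 0 := fun h =>
      fibreProj_linearised_eq_zero hP hu₂ hlam₂ hL₂0 hL₂ N₂' hN₂' isOpen_ball
        (fun w' hw' => (hσ₂ w' (ball_subset_closedBall hw')).2.2) hw hD₂d h
    refine ⟨D₁, D₂, hD₁d, hD₂d, hD₁n, hD₂n, hD₁id, hD₂id, hlin₁, hlin₂, ?_⟩
    refine ContinuousLinearMap.opNorm_le_bound _ (mul_nonneg (mul_nonneg (inv_nonneg.2 hpos.le) (by positivity)) hK0)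
      fun h => ?_
    have hQ : Dop'' (D₁ h) = Dop'' (D₂ h) := by
      rw [← ContinuousLinearMap.comp_apply, hD₁id, ← ContinuousLinearMap.comp_apply, hD₂id]
    have hg := norm_mulSub_le (m₁ := fun q => u₁' (σ₁ w q)) (m₂ := fun q => u₂' (σ₂ w q))
      (g₁ := N₁' (σ₁ w) (D₁ h)) (g₂ := N₂' (σ₂ w) (D₂ h)) (h₁ := D₁ h) (h₂ := D₂ h)
      (fun q => hN₁' _ _ q) (fun q => hN₂' _ _ q) lam.coe_nonneg hη0 (fun q => hlam₁ _) (hmul w hw)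
    have hb := norm_sub_le_of_linearised_pair Rop hR T hT N.2 hTN' hPn hQ (hlin₁ h) (hlin₂ h) hg hsmall
    rw [_root_.sub_apply]
    refine hb.trans ?_
    have h2 : ‖D₂ h‖ ≤ ((N : ℝ)⁻¹ - c)⁻¹ * ‖h‖ := (D₂.le_opNorm h).trans (mul_le_mul_of_nonneg_right hD₂n (norm_nonneg h))
    have h3 : 0 ≤ (1 - 2 * (lam : ℝ) * N)⁻¹ * (2 * N * (δ' + L₂ * ((1 - 2 * (lam : ℝ) * N)⁻¹ * (2 * N * δ)))) :=
      mul_nonneg (inv_nonneg.2 hpos.le) (by positivity)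
    calc (1 - 2 * (lam : ℝ) * N)⁻¹ * (2 * N * (δ' + L₂ * ((1 - 2 * (lam : ℝ) * N)⁻¹ * (2 * N * δ))) * ‖D₂ h‖)
        = (1 - 2 * (lam : ℝ) * N)⁻¹ * (2 * N * (δ' + L₂ * ((1 - 2 * (lam : ℝ) * N)⁻¹ * (2 * N * δ)))) * ‖D₂ h‖ := by
          ring
      _ ≤ (1 - 2 * (lam : ℝ) * N)⁻¹ * (2 * N * (δ' + L₂ * ((1 - 2 * (lam : ℝ) * N)⁻¹ * (2 * N * δ))))
            * (((N : ℝ)⁻¹ - c)⁻¹ * ‖h‖) := mul_le_mul_of_nonneg_left h2 h3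
      _ = _ := by ring
  · -- the covariances
    obtain ⟨-, hQC₁, hfib₁, -, hCb₁, -⟩ := hint₁ w hw
    obtain ⟨-, hQC₂, hfib₂, -, hCb₂, -⟩ := hint₂ w hw
    refine ⟨fun g => ⟨hQC₁ g, hQC₂ g⟩, fun g => ⟨hfib₁ g, hfib₂ g⟩, fun g => ⟨hCb₁ g, hCb₂ g⟩, fun g => ?_⟩
    have hQ : Dop'' (Cf₁ w g) = Dop'' (Cf₂ w g) := by rw [hQC₁, hQC₂]
    have hg := norm_mulSub_le (m₁ := fun q => u₁' (σ₁ w q)) (m₂ := fun q => u₂' (σ₂ w q))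
      (g₁ := N₁' (σ₁ w) (Cf₁ w g)) (g₂ := N₂' (σ₂ w) (Cf₂ w g)) (h₁ := Cf₁ w g) (h₂ := Cf₂ w g)
      (fun q => hN₁' _ _ q) (fun q => hN₂' _ _ q) lam.coe_nonneg hη0 (fun q => hlam₁ _) (hmul w hw)
    have hb := norm_sub_le_of_linearised_pair Rop hR T hT N.2 hTN' hPn hQ (hfib₁ g) (hfib₂ g) hg hsmall
    refine hb.trans ?_
    have h3 : 0 ≤ (1 - 2 * (lam : ℝ) * N)⁻¹ * (2 * N * (δ' + L₂ * ((1 - 2 * (lam : ℝ) * N)⁻¹ * (2 * N * δ)))) :=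
      mul_nonneg (inv_nonneg.2 hpos.le) (by positivity)
    calc (1 - 2 * (lam : ℝ) * N)⁻¹ * (2 * N * (δ' + L₂ * ((1 - 2 * (lam : ℝ) * N)⁻¹ * (2 * N * δ))) * ‖Cf₂ w g‖)
        = (1 - 2 * (lam : ℝ) * N)⁻¹ * (2 * N * (δ' + L₂ * ((1 - 2 * (lam : ℝ) * N)⁻¹ * (2 * N * δ)))) * ‖Cf₂ w g‖ := by
          ring
      _ ≤ (1 - 2 * (lam : ℝ) * N)⁻¹ * (2 * N * (δ' + L₂ * ((1 - 2 * (lam : ℝ) * N)⁻¹ * (2 * N * δ))))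
            * (2 * ((N : ℝ)⁻¹ - c)⁻¹ * ‖g‖) := mul_le_mul_of_nonneg_left (hCb₂ g) h3
      _ = _ := by ring

/-! ## §4. Toy -/

/-- Toy: the constants' shapes — `N = 2`, `λ = 1∕10` (`2λN = 2∕5`, `(1 − 2λN)⁻¹ = 5∕3`), `c = 1∕5` (`(N⁻¹ − c)⁻¹ = 10∕3`), `δ = δ′ = 1∕100`,
`L₂ = 3`: `m₀ = 5∕3·4·(1∕100) = 1∕15`, `η = 1∕100 + 3∕15 = 21∕100`, response modulus `5∕3·4·(21∕100)·(10∕3) = 14∕3`. -/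
example : (1 - 2 * (1 / 10 : ℝ) * 2)⁻¹ * (2 * 2 * (1 / 100)) = 1 / 15 ∧
    (1 - 2 * (1 / 10 : ℝ) * 2)⁻¹ * (2 * 2 * (1 / 100 + 3 * (1 / 15))) * ((2 : ℝ)⁻¹ - 1 / 5)⁻¹ = 14 / 3 := by
  norm_num

end Summit.QuantumFields.BalabanUV.T4Continuum.NE7b.SupBackgroundDerivDataModulus

end
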